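import Summits.BirchSwinnertonDyer.BirchSwinnertonDyer.Theorems.KimAtThreeDeepUpperExpStarTowerRange
import Summits.BirchSwinnertonDyer.BirchSwinnertonDyer.Theorems.KimAtThreeDeepUpperExpStarUnit
import Summits.BirchSwinnertonDyer.BirchSwinnertonDyer.Theorems.KimAtThreeDeepUpperTowerLattice
import HarnessLib

/-!
# F″ programme, piece P4-coh (per-factor half): the SHARP per-factor integrality
# `exp*_{d_w}(H¹(L_w, T_pW)) ⊆ 𝒪_w` at a place `w ∣ p` of `ℚ(ζ_m)`, from an `hdual`-normalised Néron line `d`,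
# a (RES_w)-compatible line datum `d_w`, the cite fact (S5b-tower), and the RECEPTACLE's trace-dual bound at `L_w`

Cell `pub/bsd-wall`, seat `bsd-wall-manin-p1` g8 (explicit-unit; crux of record stmt-BirchSwinnertonDyer-20709
`ManinFrameResidueProperR` ⟸ F″ = `Literature.NumberTheory.EllipticCurves.kato_neron_isIntegral_twistedSymbolSum_of_additive_five_le`,
p596221); `--supports stmt-BirchSwinnertonDyer-20709` (helper). TOOL theorem only (no definition, no named fact, no `sorry`);
nothing is closed or booked; BSD / 20709 / 22226 are not proved by any of this. CONDITIONAL on ONE displayed Literature cite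
fact (S5b-tower) `PAdicHodge.exists_smul_range_expStarCoord_tower_iff_trace_log`, exactly as its W2 template.

WHAT. This is the W2 cell's `KimAtThreeDeepUpperTowerLattice.pow_three_mul_expStarOmegaHom_mem_of_facts` (seat w2-c3 gen 8:
`p³ · exp*_{dw}(z) ∈ 𝒪_{w₀}` at EVERY place, any ramification, with the CRUDE points-side bound `p²𝒪 ⊆ log_ω E(L_w)`)
with the crude steps (3)–(4) REPLACED by a displayed receptacle hypothesis — so that NO power of `p` is lost, which is
what the F″ programme needs (roadmap `Cruxes/ManinFrameResidueProper/P4-ROADMAP-manin-p1-g8.md` §2, items 3–5):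

★★ `expStarOmegaHom_mem_adicCompletionIntegers_of_facts_of_receptacle` — for `W/ℚ` globally minimal, ANY prime `p`,
a local Néron line `d` at `v_p` with Prop-1.2.3 binders and `hdual` (read in `ℚ_p` through `e_p⁻¹`, W2's shape), ANY
level `m` (`ℚ(ζ_m)`, `m ≥ 1`), ANY place `w₀ ∣ p`, any compatible `ℝ≥0`-valuation `ν` on `L_{w₀}` making `W ⊗ L_{w₀}`
integral, every line datum `dw` of the tower representation with Prop-1.2.3 binders and (RES_w)
`exp*_{dw} ∘ res = (ℚ_v → L_{w₀}) ∘ exp*_d`, and the RECEPTACLE at `L_{w₀}` in (S5b)'s own currency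
`hrec : ∀ a, (∀ P′ ∈ E(L_{w₀}), ‖Tr_{L_{w₀}/ℚ_p}(a · log_ν P′)‖ ≤ 1) → a ∈ 𝒪_{w₀}`:
**`exp*_{dw}(z) ∈ 𝒪_{w₀}` for every `z ∈ H¹(L_{w₀}, T_pW)`.** Chain (all tree theorems, `p`-generic): (S5b-tower)
instantiated (`KimAtThreeDeepUpperExpStarTowerRange.exists_smul_ranges_of_facts`) gives ONE `e ∈ ℚ_vˣ` with `hdual(e•d)`
and `range(exp*_{e•dw}) = {a : ∀ P′, ‖Tr(a·log_ν P′)‖ ≤ 1}`; the UNIT STEP (`KimAtThreeDeepUpperExpStarUnit.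
mem_integers_of_hdual_smul`, stratum-free) gives `e ∈ 𝒪_v ↦ 𝒪_{w₀}`; `hrec` puts `exp*_{e•dw}(z)` in `𝒪_{w₀}`; and
`exp*_{dw} = e · exp*_{e•dw}` (`expStarOmega_smul`).

HOW IT IS USED (roadmap §2): at an additive `p ≥ 5` with F″'s clause and `p ∤ m`, `hrec` is the receptacle exit of seat
bsd-line-edix-p2 g4 (`ReceptacleTorsion.norm_le_one_of_forall_point_Kw_of_katoClause`, p599280, kport's `Kw p L w₀`
currency — one junction lemma `Kw`/`curveK` ↔ `w₀.1.adicCompletion`/`W.baseChange` away); the (DEF) clause of a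
`Kato2004.DefinedExpStarBody`-shaped P1 reads `Ψ(Λ y) w` as the Galois transport of such an `exp*_{dw}(ψT)`, and
`SemiLocalDescent.mem_adicCompletionIntegers_of_eq_galAdicCompletionMap` (p598912) turns this file's conclusion into the
`hint` binder of the descent `SemiLocalDescent.exists_not_dvd_isIntegral_charSum_of_forall_semilocal_mem`.

References: [Kato1993LNM1553] Ch. II §1.2.4, Prop. 1.2.3, Thm. 1.4.1 (3)–(4); [BlochKato1990] §3 Prop. 3.8, Ex. 3.11;
[KimNakamura2020] Cor. 2.4 (the receptacle this file takes as `hrec`); [CasselsFrohlichANT1967] Ch. II §10 (10.2);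
[SerreLocalFields1979] II §1–§5; W2 template `KimAtThreeDeepUpperTowerLattice` (seat w2-c3 gen 8).
-/

set_option autoImplicit false
-- the Theorems namespace of a single-conjunct summit repeats the summit name by design (D-0017)
set_option linter.dupNamespace false

noncomputable section

open scoped NumberField NNReal Classical
open Field ValuativeRel IsDedekindDomain NumberField
open Literature.NumberTheory.GaloisRepresentations
open Literature.NumberTheory.GaloisRepresentations.PeriodRingData
open Literature.NumberTheory.PAdicHodge
open Literature.NumberTheory.EllipticCurves WeierstrassCurve
open Literature.NumberTheory.EllipticCurves.FormalGroupChart (padicLogPointFiniteExt)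
open Literature.NumberTheory.AdelicBaseChange
open Summit.BirchSwinnertonDyer.BirchSwinnertonDyer.Theorems.KimAtThreeDeepLowerExpStarOmega
open Summit.BirchSwinnertonDyer.BirchSwinnertonDyer.Theorems.KimAtThreeDeepLowerExpStarOmegaPlace
open Summit.BirchSwinnertonDyer.BirchSwinnertonDyer.Theorems.KimAtThreeDeepUpperExpStarTowerRange
open Summit.BirchSwinnertonDyer.BirchSwinnertonDyer.Theorems.KimAtThreeDeepUpperExpStarUnit
open Summit.BirchSwinnertonDyer.BirchSwinnertonDyer.Theorems.KPort
open Summit.BirchSwinnertonDyer.Rank1Residual.GaloisImage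
open Summit.BirchSwinnertonDyer.Rank1Residual.Additive.LocalLog (padicLog)
open Rat.HeightOneSpectrum

namespace Summit.BirchSwinnertonDyer.BirchSwinnertonDyer.Theorems.PerFactorExpStarIntegral

variable (p : ℕ) [hp : Fact p.Prime]

attribute [local instance] KimAtThreeDeepUpperTowerLattice.fact_natCast_mem_primesEquiv_symm
-- the tree's `ℚ`-algebra structure on `ℚ_v` first (see `KimAtThreeDeepUpperExpStarFacts`)
attribute [local instance 100000] NumberField.Place.instAlgebraCompletion
attribute [local instance] valuativeRelPlace topologicalSpacePlace
attribute [local instance] isNonarchimedeanLocalField_place charZero_place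
attribute [local instance] padicAlgebraPlace fact_not_isUnit_place isAdicComplete_place

set_option backward.isDefEq.respectTransparency false in
/-- ★★ **The SHARP per-factor integrality of the defined dual exponential, from the receptacle.** For `W/ℚ`
globally minimal, a local Néron line `d` at `v_p` with Prop-1.2.3 binders and `hdual` (read in `ℚ_p` through `e_p⁻¹`),
any level `m`, any place `w₀ ∣ p` of `L = ℚ(ζ_m)`, any compatible valuation `ν` on `L_{w₀}` with `W ⊗ L_{w₀}`
`ν`-integral, and every line datum `dw` of the tower representation at `L_{w₀}` with Prop-1.2.3 binders and (RES_w)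
`exp*_{dw} ∘ res = (ℚ_v → L_{w₀}) ∘ exp*_d`: IF the receptacle holds at `L_{w₀}` — every `a ∈ L_{w₀}` with
`‖Tr_{L_{w₀}/ℚ_p}(a · log_ν P′)‖ ≤ 1` for all `P′ ∈ E(L_{w₀})` lies in `𝒪_{w₀}` (Kim–Nakamura Cor. 2.4 at an
additive `p ≥ 5` over an unramified `L_{w₀}`: the tree's `ReceptacleTorsion.*`) — THEN
**`exp*_{dw}(z) ∈ 𝒪_{w₀}` for every `z ∈ H¹(L_{w₀}, T_pW)`**. Chain: (S5b-tower) ⇒ ONE rescaling `e` with `hdual(e•d)`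
and `range(exp*_{e•dw})` = the trace-dual set; unit step ⇒ `e ∈ 𝒪_v`; `hrec`; `exp*_{dw} = e · exp*_{e•dw}`.
CONDITIONAL on the cite fact (S5b-tower) only.
[cite: Kato1993LNM1553, Ch. II §1.2.4, Thm. 1.4.1 (3)–(4)] [cite: BlochKato1990, §3 Prop. 3.8, Ex. 3.11]
[cite: KimNakamura2020, Cor. 2.4] [cite: CasselsFrohlichANT1967, Ch. II §10 Theorem (10.2)] -/
theorem expStarOmegaHom_mem_adicCompletionIntegers_of_facts_of_receptacle
    (hT₂ : exists_smul_range_expStarCoord_tower_iff_trace_log)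
    (W : WeierstrassCurve ℚ) [W.IsElliptic] [W.IsGloballyMinimal]
    (d : LocalNeronLineAt W p ((primesEquiv (R := 𝓞 ℚ)).symm ⟨p, hp.out⟩))
    (hinj : (bdRPeriodRingData (valuation_place_lt_one p ((primesEquiv (R := 𝓞 ℚ)).symm ⟨p, hp.out⟩))).CupLogInjective
      (logCyclotomic p) (localRationalTateRep W p (galRestrictPlace ((primesEquiv (R := 𝓞 ℚ)).symm ⟨p, hp.out⟩))))
    (hex : ∀ z : contOneCocycles (localRationalTateRep W p (galRestrictPlace ((primesEquiv (R := 𝓞 ℚ)).symm ⟨p, hp.out⟩))).toTopRep,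
      (bdRPeriodRingData (valuation_place_lt_one p ((primesEquiv (R := 𝓞 ℚ)).symm ⟨p, hp.out⟩))).HasDualExp (logCyclotomic p)
        (localRationalTateRep W p (galRestrictPlace ((primesEquiv (R := 𝓞 ℚ)).symm ⟨p, hp.out⟩))) fun σ => z.1 σ)
    (hdual : ∀ a : ℚ_[p], (∃ y, expStarOmegaPadicAt d hinj hex
        (((Padic.adicCompletionEquiv (𝓞 ℚ) ⟨p, hp.out⟩).symm : (((primesEquiv (R := 𝓞 ℚ)).symm ⟨p, hp.out⟩).adicCompletion ℚ) →+* ℚ_[p])) y = a) ↔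
      ∀ Q : (W.baseChange ℚ_[p]).toAffine.Point, ‖a * padicLog (W.baseChange ℚ_[p]) Q‖ ≤ 1)
    (m : ℕ) [NeZero m]
    (w₀ : ((primesEquiv (R := 𝓞 ℚ)).symm ⟨p, hp.out⟩).Extension (𝓞 (CyclotomicField m ℚ))) :
    letI := LocalField.charZero_adicCompletion w₀.1
    letI := LocalField.adicCompletionPadicAlgebra w₀.1 p (Kw.prime_mem_asIdeal w₀)
    haveI : Fact (¬ IsUnit ((p : ℕ) : integerC (w₀.1.adicCompletion (CyclotomicField m ℚ)))) := ⟨not_isUnit_natCast_integerC (LocalField.valuation_adicCompletion_natCast_lt_one w₀.1 p (Kw.prime_mem_asIdeal w₀))⟩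
    haveI := isAdicComplete_integerC_natCast (LocalField.valuation_adicCompletion_natCast_lt_one w₀.1 p (Kw.prime_mem_asIdeal w₀))
    ∀ (ν : Valuation (w₀.1.adicCompletion (CyclotomicField m ℚ)) ℝ≥0) [ν.Compatible]
      [(W.baseChange (w₀.1.adicCompletion (CyclotomicField m ℚ))).IsIntegral ν.integer]
      (dw : LocalNeronLine W (LocalField.valuation_adicCompletion_natCast_lt_one w₀.1 p (Kw.prime_mem_asIdeal w₀)) ((galRestrictPlace ((primesEquiv (R := 𝓞 ℚ)).symm ⟨p, hp.out⟩)).comp (absGaloisRestrict (((primesEquiv (R := 𝓞 ℚ)).symm ⟨p, hp.out⟩).adicCompletion ℚ) (w₀.1.adicCompletion (CyclotomicField m ℚ)))))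
      (hinjw : (bdRPeriodRingData (LocalField.valuation_adicCompletion_natCast_lt_one w₀.1 p (Kw.prime_mem_asIdeal w₀))).CupLogInjective (logCyclotomic p) (localRationalTateRep W p ((galRestrictPlace ((primesEquiv (R := 𝓞 ℚ)).symm ⟨p, hp.out⟩)).comp (absGaloisRestrict (((primesEquiv (R := 𝓞 ℚ)).symm ⟨p, hp.out⟩).adicCompletion ℚ) (w₀.1.adicCompletion (CyclotomicField m ℚ))))))
      (hexw : ∀ z : contOneCocycles (localRationalTateRep W p ((galRestrictPlace ((primesEquiv (R := 𝓞 ℚ)).symm ⟨p, hp.out⟩)).comp (absGaloisRestrict (((primesEquiv (R := 𝓞 ℚ)).symm ⟨p, hp.out⟩).adicCompletion ℚ) (w₀.1.adicCompletion (CyclotomicField m ℚ))))).toTopRep,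
        (bdRPeriodRingData (LocalField.valuation_adicCompletion_natCast_lt_one w₀.1 p (Kw.prime_mem_asIdeal w₀))).HasDualExp (logCyclotomic p) (localRationalTateRep W p ((galRestrictPlace ((primesEquiv (R := 𝓞 ℚ)).symm ⟨p, hp.out⟩)).comp (absGaloisRestrict (((primesEquiv (R := 𝓞 ℚ)).symm ⟨p, hp.out⟩).adicCompletion ℚ) (w₀.1.adicCompletion (CyclotomicField m ℚ))))) fun σ => z.1 σ),
      (∀ h : (tateLocalRep W p (Sum.inr ((primesEquiv (R := 𝓞 ℚ)).symm ⟨p, hp.out⟩))).cohomology 1,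
        expStarOmegaHom (LocalField.valuation_adicCompletion_natCast_lt_one w₀.1 p (Kw.prime_mem_asIdeal w₀)) ((galRestrictPlace ((primesEquiv (R := 𝓞 ℚ)).symm ⟨p, hp.out⟩)).comp (absGaloisRestrict (((primesEquiv (R := 𝓞 ℚ)).symm ⟨p, hp.out⟩).adicCompletion ℚ) (w₀.1.adicCompletion (CyclotomicField m ℚ)))) dw hinjw hexw
          (ContinuousRep.cohomologyRes (tateLocalRep W p (Sum.inr ((primesEquiv (R := 𝓞 ℚ)).symm ⟨p, hp.out⟩))) (absGaloisRestrict (((primesEquiv (R := 𝓞 ℚ)).symm ⟨p, hp.out⟩).adicCompletion ℚ) (w₀.1.adicCompletion (CyclotomicField m ℚ))) 1 h) =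
        algebraMap (((primesEquiv (R := 𝓞 ℚ)).symm ⟨p, hp.out⟩).adicCompletion ℚ) (w₀.1.adicCompletion (CyclotomicField m ℚ)) (expStarOmegaAt d h)) →
      (∀ a : w₀.1.adicCompletion (CyclotomicField m ℚ),
        (∀ P' : (W.baseChange (w₀.1.adicCompletion (CyclotomicField m ℚ))).toAffine.Point,
          ‖Algebra.trace ℚ_[p] (w₀.1.adicCompletion (CyclotomicField m ℚ))
              (a * padicLogPointFiniteExt ν (W.baseChange (w₀.1.adicCompletion (CyclotomicField m ℚ))) p P')‖ ≤ 1) →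
        a ∈ (w₀.1.adicCompletionIntegers (CyclotomicField m ℚ))) →
      ∀ z, expStarOmegaHom (LocalField.valuation_adicCompletion_natCast_lt_one w₀.1 p (Kw.prime_mem_asIdeal w₀)) ((galRestrictPlace ((primesEquiv (R := 𝓞 ℚ)).symm ⟨p, hp.out⟩)).comp (absGaloisRestrict (((primesEquiv (R := 𝓞 ℚ)).symm ⟨p, hp.out⟩).adicCompletion ℚ) (w₀.1.adicCompletion (CyclotomicField m ℚ)))) dw hinjw hexw z ∈ (w₀.1.adicCompletionIntegers (CyclotomicField m ℚ)) := by
  intro ν _hνc _hνi dw hinjw hexw hres hrec z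
  letI := LocalField.charZero_adicCompletion w₀.1
  letI := LocalField.adicCompletionPadicAlgebra w₀.1 p (Kw.prime_mem_asIdeal w₀)
  haveI : Fact (¬ IsUnit ((p : ℕ) : integerC (w₀.1.adicCompletion (CyclotomicField m ℚ)))) := ⟨not_isUnit_natCast_integerC (LocalField.valuation_adicCompletion_natCast_lt_one w₀.1 p (Kw.prime_mem_asIdeal w₀))⟩
  haveI := isAdicComplete_integerC_natCast (LocalField.valuation_adicCompletion_natCast_lt_one w₀.1 p (Kw.prime_mem_asIdeal w₀))
  -- `Place.Completion (inr v₀)` is `ℚ_{v₀}` by `rfl`: read the packet's algebra structure on it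
  letI instEF : Algebra (NumberField.Place.Completion (K := ℚ) (Sum.inr ((primesEquiv (R := 𝓞 ℚ)).symm ⟨p, hp.out⟩))) (w₀.1.adicCompletion (CyclotomicField m ℚ)) :=
    inferInstanceAs (Algebra (((primesEquiv (R := 𝓞 ℚ)).symm ⟨p, hp.out⟩).adicCompletion ℚ) (w₀.1.adicCompletion (CyclotomicField m ℚ)))
  -- (S5b-tower): ONE rescaling `e`
  obtain ⟨e, he, hde, hrange⟩ := exists_smul_ranges_of_facts W p ((primesEquiv (R := 𝓞 ℚ)).symm ⟨p, hp.out⟩) (LocalField.valuation_adicCompletion_natCast_lt_one w₀.1 p (Kw.prime_mem_asIdeal w₀)) hT₂ d hinj hex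
    ν dw hinjw hexw hres (((Padic.adicCompletionEquiv (𝓞 ℚ) ⟨p, hp.out⟩).symm : (((primesEquiv (R := 𝓞 ℚ)).symm ⟨p, hp.out⟩).adicCompletion ℚ) →+* ℚ_[p]))
  -- the unit step: `e ∈ 𝒪_v`
  obtain ⟨heO, -⟩ := mem_integers_of_hdual_smul W p ((primesEquiv (R := 𝓞 ℚ)).symm ⟨p, hp.out⟩) d hinj hex _ hdual he hde
  have hE0 : algebraMap (((primesEquiv (R := 𝓞 ℚ)).symm ⟨p, hp.out⟩).adicCompletion ℚ) (w₀.1.adicCompletion (CyclotomicField m ℚ)) e ≠ 0 := (map_ne_zero _).mpr he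
  have hEO : algebraMap (((primesEquiv (R := 𝓞 ℚ)).symm ⟨p, hp.out⟩).adicCompletion ℚ) (w₀.1.adicCompletion (CyclotomicField m ℚ)) e ∈ (w₀.1.adicCompletionIntegers (CyclotomicField m ℚ)) :=
    w₀.adicCompletionSemialgHom_image_adicCompletionIntegers ℚ (CyclotomicField m ℚ) ⟨e, heO, rfl⟩
  -- `exp*_{dw} z = E · a'` with `a' := exp*_{E•dw} z` in the trace dual of `log_ν E(L_{w₀})`
  have haa' : expStarOmegaHom (LocalField.valuation_adicCompletion_natCast_lt_one w₀.1 p (Kw.prime_mem_asIdeal w₀)) ((galRestrictPlace ((primesEquiv (R := 𝓞 ℚ)).symm ⟨p, hp.out⟩)).comp (absGaloisRestrict (((primesEquiv (R := 𝓞 ℚ)).symm ⟨p, hp.out⟩).adicCompletion ℚ) (w₀.1.adicCompletion (CyclotomicField m ℚ)))) dw hinjw hexw z = algebraMap (((primesEquiv (R := 𝓞 ℚ)).symm ⟨p, hp.out⟩).adicCompletion ℚ) (w₀.1.adicCompletion (CyclotomicField m ℚ)) e *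
      expStarOmegaHom (LocalField.valuation_adicCompletion_natCast_lt_one w₀.1 p (Kw.prime_mem_asIdeal w₀)) ((galRestrictPlace ((primesEquiv (R := 𝓞 ℚ)).symm ⟨p, hp.out⟩)).comp (absGaloisRestrict (((primesEquiv (R := 𝓞 ℚ)).symm ⟨p, hp.out⟩).adicCompletion ℚ) (w₀.1.adicCompletion (CyclotomicField m ℚ)))) (dw.smul (algebraMap (((primesEquiv (R := 𝓞 ℚ)).symm ⟨p, hp.out⟩).adicCompletion ℚ) (w₀.1.adicCompletion (CyclotomicField m ℚ)) e) ((map_ne_zero (algebraMap (((primesEquiv (R := 𝓞 ℚ)).symm ⟨p, hp.out⟩).adicCompletion ℚ) (w₀.1.adicCompletion (CyclotomicField m ℚ)))).mpr he))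
        hinjw hexw z := by
    rw [expStarOmegaHom_apply, expStarOmegaHom_apply, expStarOmega_smul, ← mul_assoc, mul_inv_cancel₀ hE0, one_mul]
  have hdual' := (hrange (expStarOmegaHom (LocalField.valuation_adicCompletion_natCast_lt_one w₀.1 p (Kw.prime_mem_asIdeal w₀)) ((galRestrictPlace ((primesEquiv (R := 𝓞 ℚ)).symm ⟨p, hp.out⟩)).comp (absGaloisRestrict (((primesEquiv (R := 𝓞 ℚ)).symm ⟨p, hp.out⟩).adicCompletion ℚ) (w₀.1.adicCompletion (CyclotomicField m ℚ))))
      (dw.smul (algebraMap (((primesEquiv (R := 𝓞 ℚ)).symm ⟨p, hp.out⟩).adicCompletion ℚ) (w₀.1.adicCompletion (CyclotomicField m ℚ)) e) ((map_ne_zero (algebraMap (((primesEquiv (R := 𝓞 ℚ)).symm ⟨p, hp.out⟩).adicCompletion ℚ) (w₀.1.adicCompletion (CyclotomicField m ℚ)))).mpr he)) hinjw hexw z)).mp ⟨z, rfl⟩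
  -- the receptacle: `a' ∈ 𝒪_{w₀}`
  have ha' := hrec _ hdual'
  rw [haa']
  exact mul_mem hEO ha'

end Summit.BirchSwinnertonDyer.BirchSwinnertonDyer.Theorems.PerFactorExpStarIntegral

end
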